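import Summits.CriticalPhenomena.PercolationContinuityZ3.Theorems.PercNearOneGluingAdditiveGluingCovTransferCertCheck

/-!
# `NoHeavyLowerTail` (crux stmt-CriticalPhenomena-4575), Sahi programme P1: a kernel-checkable certificate that Sahi's
# third-order inequality `E₃ ≥ 0` holds for ALL triples of increasing events of the Boolean cube `{0,1}^m` under EVERY
# product measure — the checker and its soundness

Support file (Sahi cell, seat `prim-sahi-p1`; `--supports stmt-CriticalPhenomena-4575`).  Nothing here is specific to
percolation and nothing is asserted about the crux.

Context.  Sahi [Combinatorica 28 (2008), Conj. 5] / Richards [Ann. Probab. 32 (2004)] / Kahn [arXiv:2210.08653, Conj. 5]: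
for a product measure `μ_p` on `{0,1}^m` and increasing `A, B, C`,
`E₃(A,B,C) = 2μ(ABC) + μ(A)μ(B)μ(C) − μ(A)μ(BC) − μ(B)μ(AC) − μ(C)μ(AB) ≥ 0` ("C₃"; OPEN for every `m` in print — Kahn 2022:
"thoroughly intractable"; Gladkov arXiv:2408.08457 Rem. 8.8).  The tree's `Literature.Probability.LatticeModels.sahiE3` is this
functional; its proved cases (one principal slot, a nested pair, conditional Harris) are in `…SahiThirdOrderCorrelation`,
`…SahiE3Cylinder`, `…SahiE3BlockTransfer`.  The `|A| = 5` rung of this route's one-cut ladder consumes instances of C₃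
(E3GRP rows; MASTER-FAMILY.md), which is why the Sahi cell certifies C₃ bottom-up.

Method (three copies, "Richards-comb").  With `x_i = p_i`, each `μ(X)` is the multilinear polynomial `ML` of the `0/1` corner
table of `X`, so `E₃` is a signed sum of five products of three `ML`s, a `cubicForm` of `…CovTransferCertAlgebra`; by
`cubicForm_nonneg` it is `≥ 0` on `[0,1]^m` as soon as all `4^m` three-copy fibre sums (`cubicCoef`, the tensor-Bernstein
coefficients) are `≥ 0`, and these integers are the base-`2^σ` digits of one Kronecker number (`cubicZ`,
`cubicCoef_nonneg_of_digit_ge`, AND-mask test `digit_ge_of_land`).  Here the events are arbitrary subsets of the cube given as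
BITMASKS `T < 2^(2^m)` (bit `x` = membership of the point whose coordinate set is the binary expansion of `x`):

* `tabN`, `tabZ`, `krT` — list table, corner table and Kronecker number of a bitmask; `fullN`, `tabZ_land` (intersections);
* `zE3`, `checkTriple`, `checkTriple_sound` — the certificate number of `E₃` and the digit test; if it passes, the cubic
  `2·ML(ABC) + ML(A)ML(B)ML(C) − Σ ML(A)ML(BC)` is `≥ 0` at every point of `[0,1]^m`;
* `isUpN`, `upsN`, `checkCube m σ` — the test run over all SORTED triples of increasing bitmasks (`E₃` is symmetric);
* `checkTriple_of_checkCube` — the cube check certifies every sorted triple of increasing bitmasks.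

The bridge to events `A ⊆ Set (Fin m)` and `prodBernoulli` (`sahiE3_nonneg_of_checkCube`) is `…SahiC3CubeEvents`; the
evaluations (`m ≤ 3` by `decide`, `m = 4` by `native_decide`) are `…SahiC3CubeLeThree` / `…SahiC3CubeFour`.  The fibre sums were
censused nonnegative for `m ≤ 5` exhaustively by two independent programs (ttrl2 `rcomb`, 1.93·10¹¹ values; this seat's
py/comb.py, `m ≤ 4`, 12.87 M values); `4^5` digits × `7581³/6` triples is beyond an in-kernel check.
-/

namespace Summit.CriticalPhenomena.PercolationContinuityZ3.Theorems.SahiC3Cube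

open Finset OneCutCert CovTransferCert
open scoped BigOperators

/-! ## Bitmask tables of subsets of the cube -/

/-- The `0/1` list table of a bitmask `T` of points of the `m`-cube: entry `x < 2^m` is bit `x` of `T`. [this work] -/
def tabN (m T : ℕ) : List ℕ := (List.range (2 ^ m)).map fun x => if T.testBit x then 1 else 0

/-- Length of `tabN`. [this work] -/
theorem length_tabN (m T : ℕ) : (tabN m T).length = 2 ^ m := by simp [tabN]

/-- The integer corner table of a bitmask. [this work] -/
def tabZ (m T : ℕ) : (Fin m → Bool) → ℤ := tabOf ((tabN m T).map ((↑) : ℕ → ℤ))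

/-- Entries of `tabZ`: the bit of `T` at the corner's position. [this work] -/
theorem tabZ_apply (m T : ℕ) (g : Fin m → Bool) : tabZ m T g = if T.testBit (enc2 g) then 1 else 0 := by
  unfold tabZ tabOf tabN
  rw [List.getD_eq_getElem?_getD, List.map_map, List.getElem?_map, List.getElem?_range (enc2_lt g)]
  simp only [Option.map_some, Option.getD_some, Function.comp]
  split_ifs <;> simp

/-- `|tabZ| ≤ 1`. [this work] -/
theorem abs_tabZ_le (m T : ℕ) (g : Fin m → Bool) : |tabZ m T g| ≤ 1 := by
  rw [tabZ_apply]; split_ifs <;> simp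

/-- The bitmask of the whole cube. [this work] -/
def fullN (m : ℕ) : ℕ := 2 ^ (2 ^ m) - 1

/-- The table of the whole cube is constant `1`. [this work] -/
theorem tabZ_fullN (m : ℕ) (g : Fin m → Bool) : tabZ m (fullN m) g = 1 := by
  rw [tabZ_apply, fullN, Nat.testBit_two_pow_sub_one, decide_eq_true (enc2_lt g), if_pos rfl]

/-- The table of an intersection (bitwise AND) is the product of the tables. [this work] -/
theorem tabZ_land (m A B : ℕ) (g : Fin m → Bool) : tabZ m (A &&& B) g = tabZ m A g * tabZ m B g := by
  simp only [tabZ_apply, Nat.testBit_land]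
  cases A.testBit (enc2 g) <;> cases B.testBit (enc2 g) <;> simp

/-- The real corner table of a bitmask. [this work] -/
def tabR (m T : ℕ) : (Fin m → Bool) → ℝ := fun g => (tabZ m T g : ℝ)

/-- `ML` of the whole cube is `1`. [this work] -/
theorem ML_fullN (m : ℕ) (x : Fin m → ℝ) : ML (tabR m (fullN m)) x = 1 := by
  have : tabR m (fullN m) = fun _ => (1 : ℝ) := by
    funext g; simp [tabR, tabZ_fullN]
  rw [this, ML_const]

/-- `ML` of an intersection table, pointwise form. [this work] -/
theorem tabR_land (m A B : ℕ) : tabR m (A &&& B) = fun g => tabR m A g * tabR m B g := by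
  funext g; simp [tabR, tabZ_land]

/-- Kronecker number (base `2^σ`, base-4 positions) of a bitmask table. [this work] -/
def krT (σ m T : ℕ) : ℕ := krN4 σ m (tabN m T)

/-- `krT` is the Kronecker number `KR4` of the corner table. [this work] -/
theorem krT_eq (σ m T : ℕ) : (krT σ m T : ℤ) = KR4 (2 ^ σ) (tabZ m T) := krN4_eq σ m _ (length_tabN m T)

/-! ## The certificate number of `E₃` and the digit test -/

/-- The certificate number of `E₃(A,B,C)`: `2·K(ABC)·F·F + K(A)K(B)K(C) − K(A)K(BC)F − K(B)K(AC)F − K(C)K(AB)F`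
(`F` = the Kronecker number of the whole cube). [this work] -/
def zE3 (σ m : ℕ) (F : ℤ) (A B C : ℕ) : ℤ :=
  2 * (krT σ m (A &&& B &&& C) : ℤ) * F * F + (krT σ m A : ℤ) * (krT σ m B : ℤ) * (krT σ m C : ℤ)
    - (krT σ m A : ℤ) * (krT σ m (B &&& C) : ℤ) * F - (krT σ m B : ℤ) * (krT σ m (A &&& C) : ℤ) * F
    - (krT σ m C : ℤ) * (krT σ m (A &&& B) : ℤ) * F

/-- The digit test of one triple with precomputed full-cube number `F`, offset `off` and its `toNat`. [this work] -/
def checkTripleW (σ m : ℕ) (F off : ℤ) (offN : ℕ) (A B C : ℕ) : Bool :=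
  let Z := zE3 σ m F A B C + off
  decide (0 ≤ Z) && decide ((Z.toNat &&& offN) = offN)

/-- The certificate CHECK of one triple of bitmasks in base `2^σ`: coefficient bound `6·8^m < 2^(σ-1)` and the AND-mask digit
test on `Z + offT`. [this work] -/
def checkTriple (σ m A B C : ℕ) : Bool :=
  decide (0 < σ) && decide (6 * 8 ^ m < 2 ^ (σ - 1)) &&
    checkTripleW σ m (krT σ m (fullN m)) (offT σ m) (offT σ m).toNat A B C

/-- The signs of the five cubic terms of `E₃`. [this work] -/
def sgn5 : Fin 5 → ℤ := ![2, 1, -1, -1, -1]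

/-- First factors: `ABC, A, A, B, C`. [this work] -/
def X5 (m A B C : ℕ) : Fin 5 → (Fin m → Bool) → ℤ := ![tabZ m (A &&& B &&& C), tabZ m A, tabZ m A, tabZ m B, tabZ m C]

/-- Second factors: `1, B, BC, AC, AB`. [this work] -/
def Y5 (m A B C : ℕ) : Fin 5 → (Fin m → Bool) → ℤ :=
  ![tabZ m (fullN m), tabZ m B, tabZ m (B &&& C), tabZ m (A &&& C), tabZ m (A &&& B)]

/-- Third factors: `1, C, 1, 1, 1`. [this work] -/
def Z5 (m C : ℕ) : Fin 5 → (Fin m → Bool) → ℤ :=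
  ![tabZ m (fullN m), tabZ m C, tabZ m (fullN m), tabZ m (fullN m), tabZ m (fullN m)]

set_option maxHeartbeats 800000 in
/-- **Soundness of `checkTriple`**: if the digit test passes, the cubic
`2·ML(ABC) + ML(A)ML(B)ML(C) − ML(A)ML(BC) − ML(B)ML(AC) − ML(C)ML(AB)` of the bitmask tables is nonnegative at every point of
the unit cube. [this work] -/
theorem checkTriple_sound {σ m A B C : ℕ} (h : checkTriple σ m A B C = true) {x : Fin m → ℝ} (hx : InCube x) :
    0 ≤ 2 * ML (tabR m (A &&& B &&& C)) x + ML (tabR m A) x * ML (tabR m B) x * ML (tabR m C) x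
      - (ML (tabR m A) x * ML (tabR m (B &&& C)) x + ML (tabR m B) x * ML (tabR m (A &&& C)) x
        + ML (tabR m C) x * ML (tabR m (A &&& B)) x) := by
  unfold checkTriple checkTripleW at h
  simp only [Bool.and_eq_true, decide_eq_true_eq] at h
  obtain ⟨⟨hσ, hbnd⟩, hZ, hland⟩ := h
  have hoff : offT σ m = (maskN σ (4 ^ m) : ℤ) := by
    unfold offT
    rw [off_eq σ (4 ^ m) hσ, maskN_eq_sum σ hσ, Finset.mul_sum]
  rw [hoff] at hZ hland
  rw [Int.toNat_natCast] at hland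
  -- the certificate number is `cubicZ`
  have hZeq : zE3 σ m (krT σ m (fullN m)) A B C = cubicZ (2 ^ σ) sgn5 (X5 m A B C) (Y5 m A B C) (Z5 m C) := by
    unfold zE3 cubicZ
    simp only [Fin.sum_univ_five, sgn5, X5, Y5, Z5, Matrix.cons_val_zero, Matrix.cons_val_one, Matrix.cons_val,
      krT_eq]
    ring
  -- the bound on the fibre sums
  have hB : CoefBound3 sgn5 (X5 m A B C) (Y5 m A B C) (Z5 m C) (2 ^ (σ - 1)) := by
    intro k
    have habs : ∀ j, |sgn5 j| ≤ 2 := by intro j; fin_cases j <;> simp [sgn5]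
    have hX : ∀ j g, |X5 m A B C j g| ≤ 1 := by intro j g; fin_cases j <;> exact abs_tabZ_le _ _ _
    have hY : ∀ j g, |Y5 m A B C j g| ≤ 1 := by intro j g; fin_cases j <;> exact abs_tabZ_le _ _ _
    have hZ5 : ∀ j g, |Z5 m C j g| ≤ 1 := by intro j g; fin_cases j <;> exact abs_tabZ_le _ _ _
    have h8 : ∀ j, |sgn5 j * pcoef3 (X5 m A B C j) (Y5 m A B C j) (Z5 m C j) k| ≤ |sgn5 j| * 8 ^ m := by
      intro j
      rw [abs_mul]
      exact mul_le_mul_of_nonneg_left (abs_pcoef3_le _ _ _ (hX j) (hY j) (hZ5 j) k) (abs_nonneg _)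
    have hsum : |cubicCoef sgn5 (X5 m A B C) (Y5 m A B C) (Z5 m C) k| ≤ 6 * 8 ^ m := by
      unfold cubicCoef
      calc |∑ j : Fin 5, sgn5 j * pcoef3 (X5 m A B C j) (Y5 m A B C j) (Z5 m C j) k|
          ≤ ∑ j : Fin 5, |sgn5 j * pcoef3 (X5 m A B C j) (Y5 m A B C j) (Z5 m C j) k| := Finset.abs_sum_le_sum_abs _ _
        _ ≤ ∑ j : Fin 5, |sgn5 j| * (8 : ℤ) ^ m := Finset.sum_le_sum fun j _ => h8 j
        _ = 6 * 8 ^ m := by simp [Fin.sum_univ_five, sgn5]; ring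
    have hpow : (6 : ℤ) * 8 ^ m < (2 : ℕ) ^ (σ - 1) := by exact_mod_cast hbnd
    exact lt_of_le_of_lt hsum hpow
  -- the digits
  set N : ℕ := (zE3 σ m (krT σ m (fullN m)) A B C + maskN σ (4 ^ m)).toNat with hN
  have hNZ : (N : ℤ) = cubicZ (2 ^ σ) sgn5 (X5 m A B C) (Y5 m A B C) (Z5 m C) +
      ∑ j : Fin (4 ^ m), (2 : ℤ) ^ (σ - 1) * (2 ^ σ) ^ (j : ℕ) := by
    rw [hN, Int.toNat_of_nonneg hZ, hZeq, maskN_eq_sum σ hσ, Fin.sum_univ_eq_sum_range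
      (fun j => (2 : ℤ) ^ (σ - 1) * (2 ^ σ) ^ j) (4 ^ m)]
  have hdig : ∀ j : ℕ, j < 4 ^ m → 2 ^ (σ - 1) ≤ digit (2 ^ σ) N j := digit_ge_of_land σ hσ (4 ^ m) N hland
  have hk : ∀ k, 0 ≤ cubicCoef sgn5 (X5 m A B C) (Y5 m A B C) (Z5 m C) k :=
    cubicCoef_nonneg_of_digit_ge hσ hB N hNZ hdig
  have hF : 0 ≤ cubicForm sgn5 (X5 m A B C) (Y5 m A B C) (Z5 m C) x := cubicForm_nonneg hk hx
  unfold cubicForm at hF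
  simp only [Fin.sum_univ_five, sgn5, X5, Y5, Z5, Matrix.cons_val_zero, Matrix.cons_val_one, Matrix.cons_val] at hF
  have h1 : ML (fun g => ((tabZ m (fullN m) g : ℤ) : ℝ)) x = 1 := ML_fullN m x
  rw [h1] at hF
  unfold tabR
  push_cast at hF
  linarith

/-! ## Increasing bitmasks and the check over all sorted triples -/

/-- A bitmask is increasing (an up-set of the cube): membership is preserved when a coordinate is switched on. [this work] -/
def isUpN (m T : ℕ) : Bool :=
  (List.range (2 ^ m)).all fun x => (List.range m).all fun i => !(T.testBit x) || T.testBit (x ||| 2 ^ i)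

/-- All increasing bitmasks of the `m`-cube (the free distributive lattice; `6, 20, 168` for `m = 2, 3, 4`). [this work] -/
def upsN (m : ℕ) : List ℕ := (List.range (2 ^ (2 ^ m))).filter (isUpN m)

/-- **The cube check**: the digit test for every sorted triple `A ≤ B ≤ C` of increasing bitmasks (sharing `F` and the
offset). [this work] -/
def checkCube (m σ : ℕ) : Bool :=
  let ups := upsN m
  let F : ℤ := krT σ m (fullN m)
  let off := offT σ m
  let offN := off.toNat
  decide (0 < σ) && decide (6 * 8 ^ m < 2 ^ (σ - 1)) &&
    ups.all fun A => ups.all fun B => ups.all fun C =>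
      decide (B < A) || decide (C < B) || checkTripleW σ m F off offN A B C

/-- `checkCube` certifies every sorted triple of increasing bitmasks. [this work] -/
theorem checkTriple_of_checkCube {m σ : ℕ} (h : checkCube m σ = true) {A B C : ℕ} (hA : A ∈ upsN m) (hB : B ∈ upsN m)
    (hC : C ∈ upsN m) (hAB : A ≤ B) (hBC : B ≤ C) : checkTriple σ m A B C = true := by
  unfold checkCube at h
  simp only [Bool.and_eq_true, decide_eq_true_eq, List.all_eq_true, Bool.or_eq_true] at h
  obtain ⟨⟨hσ, hbnd⟩, hall⟩ := h
  have := hall A hA B hB C hC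
  unfold checkTriple
  simp only [Bool.and_eq_true, decide_eq_true_eq]
  refine ⟨⟨hσ, hbnd⟩, ?_⟩
  rcases this with (h1 | h2) | h3
  · exact absurd hAB (not_le.2 h1)
  · exact absurd hBC (not_le.2 h2)
  · exact h3

end Summit.CriticalPhenomena.PercolationContinuityZ3.Theorems.SahiC3Cube
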